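import Summits.KontsevichZagierPeriods.Zeta5Search.WedgeDictionaryDescent22Weak
import Summits.KontsevichZagierPeriods.Zeta5Search.SymRayInitialValues
import Summits.KontsevichZagierPeriods.Zeta5Search.WedgeDictionaryInstanceTwos
import HarnessLib

/-!
# The `P̂`-third of the wedge dictionary from Brown–Zudilin (22) on the CLOSED Bailey cone (gen-1 g11)

HONEST FRAMING: systematic search; no irrationality claim unless certified.

OUR work (Summit side; cell `pub-zeta5`, planner gen-1 g11, 2026-08-20), the sequel of `WedgeDictionaryDescent22` (gen-1 g10).
There, the `ζ(2)`-companion ("`P̂`-third") of the open half `explicitPQ` of the wedge dictionary was reduced, in Brown–Zudilin's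
residue range `p₄+q₄ ≤ p₃`, to three cited facts (`phatPart_of_descent22`), under the proviso `StrictTerms`: every level-5 vector
`B(k)` in the binomial support of (22) STRICTLY admissible (Zudilin 2004 (4.12), all sixteen `c_jk > 0`) — because the Bailey /
Rhin–Viola invariance was typed on the open cone only.  That proviso excludes Brown–Zudilin's own first example `a = (1,…,1)`
(arXiv:2210.03391 Sect. 2, `n = 1`; its second term has `B(2) = (3;1,0,1,1,1)`), and more generally every `a` whose support reaches a face of the cone.

This file removes it.  With the invariance typed on the CLOSED cone — `Zudilin2004.baileyTransformClosed`
(`GroupStructureZeta3Closed`: the standing hypothesis (2.2) of the source, all sixteen `c_jk ≥ 0`, `WeakAdmissible`) — the natural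
proviso is exactly CLAUSE 2 of the proved level descent, `c₁₂ ≤ d + i_lo` (`i_lo = max(0, b₇−b₁, b₇−b₂)`): under the hypotheses of
the reduction, clause 2 makes EVERY `B(k)` of the support weakly admissible (`weakAdmissible_bFive`, sixteen linear inequalities,
`omega`), and conversely it is what the level-descent theorems `levelDescentW_holds` / `levelDescentV_holds` require (without it a
transported degenerate-shape series diverges: e.g. `a = (1,3,1,3,1,1,1,1)`, `k = 1`, `c₂₅(B(1)) = −1`).  Cell census (exact, local,
`code/gen1/g11/weak_terms_cl2.py`): in the box `{1,…,4}⁸`, 8856 points `a` satisfy the ten hypotheses of `phatPartResidueLD` below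
(3946 of them satisfy `StrictTerms`); in `{0,…,5}⁸`, 54162, and at all of them every support term is weakly admissible (0 exceptions).
Also removed: the provisos `J3TermsConverge` of (22), which are automatic for convergent `a` in the residue range
(`j3TermsConverge_of_converges`, three of the seventeen forms (3)).

## Contents
* `phatPartResidueLD` — the `P̂`-third in the residue range with clause 2 in place of `StrictTerms` and no `J3TermsConverge` proviso
  (obligation node; implied by `explicitPQ`: `phatPartLD_of_explicitPQ`; implies g10's node: `phatPartResidue_of_LD`);
* PROVED `j3TermsConverge_of_converges : Converges a → p₄+q₄ ≤ p₃ → J3TermsConverge (p(a)) (q(a))`;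
* **`phatPartLD_of_descent22 : descent22 → Zudilin2002.vwp_eq_integral_of_pos → Zudilin2004.baileyTransformClosed → phatPartResidueLD`**
  (KERNEL-CHECKED REDUCTION, from the closed-cone transport lemmas of `WedgeDictionaryDescent22Weak` and the tree's level-descent
  theorems and `Q`-half), and `phatPart_of_descent22_closed` (g10's node from the closed-cone fact);
* END-TO-END INSTANCES `phatOne_of_descent22`, `phatTwo_of_descent22`: at `a = (1,…,1)` and `a = (2,…,2)`, `j = 1`, the three facts
  give, by the kernel and the tree's exact tables, `∃ P ∈ ℚ, I(1⁸) = 21·(2ζ(5)+4ζ(3)ζ(2)) − 4·(101/4)·ζ(2) − 2P` and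
  `∃ P ∈ ℚ, I(2⁸) = 2989·(2ζ(5)+4ζ(3)ζ(2)) − 4·(344923/96)·ζ(2) − 2P` — Brown–Zudilin's printed `Q₁ = 21`, `P̂₁ = 101/4`, `Q₂ = 2989`,
  `P̂₂ = 344923/96` (Sect. 2, (5)); `a = 1⁸` lies outside g10's `StrictTerms`.
What this is NOT: a proof of `explicitPQ` (the `ζ(5)`-companion `P = ρ(W′V − WV′)` still has no printed handle), nor of (22), nor of the
cited Bailey invariance; nothing about irrationality.
-/

noncomputable section

open Finset

namespace Summit.KontsevichZagierPeriods.Zeta5Search.WedgeDictionary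

open Summit.KontsevichZagierPeriods.Zeta5Search.DualSeries
open Literature.NumberTheory.Irrationality.BrownZudilin2022
  (vwpDual hOfB bOfA pOf qOf Converges convergenceForms cellularIntegral QOf zchoose J3 w22 rhs22 J3TermsConverge descent22)
open Literature.NumberTheory.Irrationality.Zudilin2002 (vwpSeries sorokinIntegral sorokinIntegrand vwp_eq_integral_of_pos)
open Literature.NumberTheory.Irrationality.Zudilin2004
  (Admissible WeakAdmissible cParams piNorm tau134 baileyTransform baileyTransformClosed weakAdmissible_tau134)
open Literature.NumberTheory.Transcendental (zetaValue)

/-! ### The statement -/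

/-- **The `P̂`-third of the analytic wedge dictionary in the residue range, closed-cone form (INTERNALLY MINTED obligation node;
implied by `explicitPQ` — `phatPartLD_of_explicitPQ` — and, modulo three cited facts, PROVED — `phatPartLD_of_descent22`).**
For `a`, `j` in the region of `explicitPQ` with moreover `2b_k ≤ b₀` (level-descent box), `(p;q) ≥ 0`, `p₄+q₄ ≤ p₃` (residue range)
and clause 2 of the level descent `c₁₂ ≤ d + max(0, b₇−b₁, b₇−b₂)` (ten hypotheses; the provisos `J3TermsConverge` of (22) are automatic
here, `j3TermsConverge_of_converges`):
`∃ P ∈ ℚ, I(a) = Q(a)(2ζ(5) + 4ζ(3)ζ(2)) − 4ρ(a)(U(b)V(b′) − U(b′)V(b))ζ(2) − 2P`, `b = b(a)`, `b′ = b + e_j`. -/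
@[conjecture] def phatPartResidueLD : Prop :=
  ∀ (a : Fin 8 → ℤ) (j : ℕ), j ∈ Icc 1 7 → Converges a →
    (∀ i ∈ Icc 1 7, 0 ≤ bOfA a i ∧ 2 * bOfA a i ≤ bOfA a 0 + 1) → 0 ≤ dOf (bOfA a) →
    2 * (bOfA a j + 1) ≤ bOfA a 0 + 1 → (∀ i ∈ Icc 1 7, 2 * bOfA a i ≤ bOfA a 0) →
    (∀ i, 0 ≤ pOf a i) → (∀ i, 0 ≤ qOf a i) → pOf a 4 + qOf a 3 ≤ pOf a 3 →
    bOfA a 0 - bOfA a 1 - bOfA a 2 ≤ dOf (bOfA a) + max 0 (max (bOfA a 7 - bOfA a 1) (bOfA a 7 - bOfA a 2)) →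
    ∃ P : ℚ, cellularIntegral a =
      (QOf a : ℝ) * (2 * zetaValue 5 + 4 * zetaValue 3 * zetaValue 2) -
        4 * ((rhoOf a * (coeffU (bOfA a) * coeffV (Function.update (bOfA a) j (bOfA a j + 1)) -
              coeffU (Function.update (bOfA a) j (bOfA a j + 1)) * coeffV (bOfA a)) : ℚ) : ℝ) * zetaValue 2 -
        2 * (P : ℝ)

/-! Sanity check (not citable): Brown–Zudilin's first example `a = (1,…,1)` satisfies all ten hypotheses (at every `j`) and the provisos
of (22), but NOT `StrictTerms` — its second term `k = 2` has the weakly, not strictly, admissible vector `B(2) = (3;1,0,1,1,1)`. -/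
example :
    let a : Fin 8 → ℤ := fun _ => 1
    Converges a ∧ (∀ i ∈ Icc 1 7, 0 ≤ bOfA a i ∧ 2 * bOfA a i ≤ bOfA a 0 + 1) ∧ 0 ≤ dOf (bOfA a) ∧
      (∀ j ∈ Icc 1 7, 2 * (bOfA a j + 1) ≤ bOfA a 0 + 1) ∧ (∀ i ∈ Icc 1 7, 2 * bOfA a i ≤ bOfA a 0) ∧ (∀ i, 0 ≤ pOf a i) ∧
      (∀ i, 0 ≤ qOf a i) ∧ pOf a 4 + qOf a 3 ≤ pOf a 3 ∧ J3TermsConverge (pOf a) (qOf a) ∧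
      bOfA a 0 - bOfA a 1 - bOfA a 2 ≤ dOf (bOfA a) + max 0 (max (bOfA a 7 - bOfA a 1) (bOfA a 7 - bOfA a 2)) ∧
      ¬ StrictTerms a ∧ (List.range 6).map (bFive a 2) = [3, 1, 0, 1, 1, 1] ∧ WeakAdmissible (bFive a 2) := by
  decide

/-- The provisos `J3TermsConverge` of (22) are AUTOMATIC for convergent `a` in the residue range: for `k` in the support
with `p₆ ≤ k`, `p₃ − k ≥ 0` is the residue range, `q₃ − p₆ + k ≥ q₃ = a₁+a₅−a₃ ≥ 0`, and since `p₁ + q₃ − p₆ = a₅` and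
`p₂ + q₃ − p₆ = a₄+a₅+a₈−a₂−a₃` the last two conditions follow from `p₄ = a₇ ≤ k`, `p₆ ≤ k` and the forms `a₇+a₈−a₆ ≥ 0`,
`a₁+a₈−a₃ ≥ 0` of (3) — linear, `omega`. -/
theorem j3TermsConverge_of_converges (a : Fin 8 → ℤ) (hconv : Converges a) (hres : pOf a 4 + qOf a 3 ≤ pOf a 3) :
    J3TermsConverge (pOf a) (qOf a) := by
  have h8 : 0 ≤ a 0 + a 4 - a 2 := hconv _ (by simp [convergenceForms])
  have h11 : 0 ≤ a 6 + a 7 - a 5 := hconv _ (by simp [convergenceForms])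
  have h14 : 0 ≤ a 0 + a 7 - a 2 := hconv _ (by simp [convergenceForms])
  intro k hk h6
  have hk' := mem_Icc.1 hk
  have ep0 : pOf a 0 = a 4 + a 5 - a 7 := by simp [pOf]
  have ep1 : pOf a 1 = a 1 + a 2 + a 5 - a 3 - a 7 := by simp [pOf]
  have ep2 : pOf a 2 = a 5 := by simp [pOf]
  have ep3 : pOf a 3 = a 1 + a 2 + a 5 - a 7 := by simp [pOf]
  have ep4 : pOf a 4 = a 6 := by simp [pOf]
  have ep6 : pOf a 6 = a 0 + a 1 + a 5 - a 3 - a 7 := by simp [pOf]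
  have eq2 : qOf a 2 = a 0 + a 4 - a 2 := by simp [qOf]
  have eq3 : qOf a 3 = a 0 := by simp [qOf]
  refine ⟨?_, ?_, ?_, ?_⟩ <;> omega

/-- The easy direction: `explicitPQ` gives `phatPartResidueLD` with `P = ρ(W′V − WV′)`. -/
theorem phatPartLD_of_explicitPQ (h : explicitPQ) : phatPartResidueLD := by
  intro a j hj hconv hreg hd hpart _ _ _ _ _
  exact ⟨_, h a j hj hconv hreg hd hpart⟩

/-- `phatPartResidueLD` implies g10's node `phatPartResidue`: strict admissibility of the first support term gives clause 2. -/
theorem phatPartResidue_of_LD (h : phatPartResidueLD) : phatPartResidue := by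
  intro a j hj hconv hreg hd hpart h2b hp hq hres _ hstrict
  refine h a j hj hconv hreg hd hpart h2b hp hq hres ?_
  have e71 : bOfA a 7 - bOfA a 1 = pOf a 6 - pOf a 4 := by simp [bOfA, pOf]; ring
  have e72 : bOfA a 7 - bOfA a 2 = pOf a 5 - pOf a 4 := by simp [bOfA, pOf]; ring
  have e12 : bOfA a 0 - bOfA a 1 - bOfA a 2 = qOf a 3 := by simp [bOfA, qOf]
  rw [e71, e72, e12]
  by_cases hle : max 0 (max (pOf a 6 - pOf a 4) (pOf a 5 - pOf a 4)) ≤ qOf a 3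
  · have hk0 : pOf a 4 + max 0 (max (pOf a 6 - pOf a 4) (pOf a 5 - pOf a 4)) ∈ Icc (pOf a 4) (pOf a 4 + qOf a 3) :=
      mem_Icc.2 ⟨by omega, by omega⟩
    have hadm := hstrict _ hk0 (by omega) (by omega)
    have hadmT : Admissible (tShape a (pOf a 4 + max 0 (max (pOf a 6 - pOf a 4) (pOf a 5 - pOf a 4)))) := by
      rw [← tau134_bFive]; exact admissible_tau134 hadm
    obtain ⟨-, -, -, -, -, tS, -⟩ := tShape_ineqs a _ hadmT
    rw [dOf_bOfA]
    simp [bOfA, pOf, qOf] at tS ⊢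
    omega
  · push Not at hle; linarith

/-! ### The assembly -/

/-- **THE REDUCTION, closed cone.**  Brown–Zudilin (22) ∧ Zudilin 2002 (k = 3) ∧ the Bailey / Rhin–Viola invariance on the closed cone
(2.2) ⟹ the `P̂`-third of the analytic wedge dictionary in the residue range, with clause 2 of the level descent as the only proviso on
the support (the level-descent theorems, the `Q`-half and the transport dictionary are tree theorems; the provisos of (22) are discharged
by `j3TermsConverge_of_converges`). -/
theorem phatPartLD_of_descent22 (h22 : descent22) (hZ : vwp_eq_integral_of_pos) (hBc : baileyTransformClosed) :
    phatPartResidueLD := by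
  intro a j hj hconv hreg hd hpart h2b hp hq hres hcl2
  have hJ : J3TermsConverge (pOf a) (qOf a) := j3TermsConverge_of_converges a hconv hres
  obtain ⟨P, hI⟩ := h22 a hconv hp hq hres hJ
  refine ⟨P, ?_⟩
  have hterms : ∀ k ∈ Icc (pOf a 4) (pOf a 4 + qOf a 3), pOf a 5 ≤ k → pOf a 6 ≤ k → WeakAdmissible (bFive a k) :=
    fun k hk h5 h6 => weakAdmissible_bFive a k hreg h2b hcl2 hk h5 h6 hres
  have e71 : bOfA a 7 - bOfA a 1 = pOf a 6 - pOf a 4 := by simp [bOfA, pOf]; ring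
  have e72 : bOfA a 7 - bOfA a 2 = pOf a 5 - pOf a 4 := by simp [bOfA, pOf]; ring
  have e12 : bOfA a 0 - bOfA a 1 - bOfA a 2 = qOf a 3 := by simp [bOfA, qOf]
  have e7 : bOfA a 7 = pOf a 3 - pOf a 4 := by simp [bOfA, pOf]; ring
  have hIn : InBox (bOfA a) := inBox_of_region (bOfA a) hreg hj hpart
  have hc12 : bOfA a 0 - bOfA a 1 - bOfA a 2 ≤ bOfA a 7 := by rw [e12, e7]; linarith
  have hmin : min (bOfA a 0 - bOfA a 1 - bOfA a 2) (bOfA a 7) = qOf a 3 := by rw [min_eq_left hc12, e12]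
  have hW := levelDescentW_holds (bOfA a) j hj hIn h2b hd hcl2
  have hV := levelDescentV_holds (bOfA a) j hj hIn h2b hd hc12 hcl2
  have hQ := wedgeDictionary_Q a j hj hconv hreg hd hpart
  rw [hmin] at hW hV
  rw [hW] at hQ
  -- the key identity: RHS(22) = 2Q ζ(3) − 2ρ·(UV′ − U′V)
  have key : rhs22 (pOf a) (qOf a) = 2 * ((QOf a : ℚ) : ℝ) * zetaValue 3 -
      2 * ((rhoOf a * (coeffU (bOfA a) * coeffV (Function.update (bOfA a) j (bOfA a j + 1)) -
              coeffU (Function.update (bOfA a) j (bOfA a j + 1)) * coeffV (bOfA a)) : ℚ) : ℝ) := by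
    rw [hQ, hV]
    set iLo := max 0 (max (bOfA a 7 - bOfA a 1) (bOfA a 7 - bOfA a 2)) with hi_def
    have hi' : iLo = max 0 (max (pOf a 6 - pOf a 4) (pOf a 5 - pOf a 4)) := by rw [hi_def, e71, e72]
    have hR : 2 * (((rhoOf a * ∑ i ∈ Icc iLo (qOf a 3), ldWeight (bOfA a) i * coeffW (degShape (bOfA a) i)) : ℚ) : ℝ) *
          zetaValue 3 -
        2 * (((rhoOf a * ∑ i ∈ Icc iLo (qOf a 3), ldWeight (bOfA a) i * coeffV (degShape (bOfA a) i)) : ℚ) : ℝ) =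
        ∑ i ∈ Icc iLo (qOf a 3), ((2 * rhoOf a * ldWeight (bOfA a) i : ℚ) : ℝ) *
          ((coeffW (degShape (bOfA a) i) : ℝ) * zetaValue 3 - coeffV (degShape (bOfA a) i)) := by
      push_cast
      rw [Finset.mul_sum, Finset.mul_sum, Finset.mul_sum, Finset.sum_mul, Finset.mul_sum, ← Finset.sum_sub_distrib]
      refine Finset.sum_congr rfl fun i _ => ?_
      ring
    rw [hR]
    unfold rhs22
    have hsub : Icc (pOf a 4 + iLo) (pOf a 4 + qOf a 3) ⊆ Icc (pOf a 4) (pOf a 4 + qOf a 3) :=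
      Icc_subset_Icc (by rw [hi']; omega) le_rfl
    rw [← Finset.sum_subset hsub]
    · rw [← Finset.map_add_left_Icc, Finset.sum_map]
      refine Finset.sum_congr rfl fun i hi => ?_
      have hi2 := mem_Icc.1 hi
      have hk : pOf a 4 + i ∈ Icc (pOf a 4) (pOf a 4 + qOf a 3) := mem_Icc.2 ⟨by rw [hi'] at hi2; omega, by omega⟩
      have h5 : pOf a 5 ≤ pOf a 4 + i := by rw [hi'] at hi2; omega
      have h6 : pOf a 6 ≤ pOf a 4 + i := by rw [hi'] at hi2; omega
      have := term22_eq_weak hZ hBc a (pOf a 4 + i) hreg hp hk h5 h6 hJ (hterms _ hk h5 h6)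
      simpa only [addLeftEmbedding_apply, add_sub_cancel_left] using this
    · intro k hk hk'
      have hk2 := mem_Icc.1 hk
      have hlt : k < pOf a 6 ∨ k < pOf a 5 := by
        rw [hi'] at hk'
        simp only [mem_Icc, not_and, not_le] at hk'
        by_contra hcon
        push Not at hcon
        have := hk' (by omega)
        omega
      have hw0 : w22 (pOf a) (qOf a) k = 0 := by
        unfold w22
        rcases hlt with h | h
        · rw [show zchoose k (pOf a 6) = 0 by rw [zchoose, if_neg (by omega)]]; ring
        · rw [show zchoose (qOf a 4) (k - pOf a 5) = 0 by rw [zchoose, if_neg (by omega)]]; ring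
      rw [hw0]; simp
  rw [hI, key]
  push_cast
  ring

/-- g10's node from the closed-cone fact (equivalently: through `baileyTransform_of_closed` and `phatPart_of_descent22`). -/
theorem phatPart_of_descent22_closed (h22 : descent22) (hZ : vwp_eq_integral_of_pos) (hBc : baileyTransformClosed) :
    phatPartResidue :=
  phatPartResidue_of_LD (phatPartLD_of_descent22 h22 hZ hBc)

/-! ### Brown–Zudilin's first example, end to end

At `a = (1,…,1)`, `j = 1` the node specialises — with the tree's exact tables `U(3;1⁷) = 18`, `W = 66`, `V = 98`, `U(3;2,1⁶) = −4`,
`W = −24`, `V = −33` (`WedgeDictionaryInstances`, `SymRayInitialValues`, kernel arithmetic on explicit partial-fraction data),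
`ρ(1⁸) = −1/8` and `Q(1⁸) = 21` — to the `n = 1` case of the source's decomposition (5), `I₁ = Q₁(2ζ(5)+4ζ(3)ζ(2)) − 4P̂₁ζ(2) − 2P₁`,
with `Q₁ = 21` and `P̂₁ = ρ(UV′ − U′V) = (−1/8)·(18·(−33) − (−4)·98) = 101/4`: the printed values (arXiv:2210.03391 Sect. 2; there also
`P₁ = 87/4`, about which the node says nothing).  The second support term of (22) at this point is `B(2) = (3;1,0,1,1,1)`, on a face of
the cone (`¬ StrictTerms`, see the sanity check above), so this instance is out of reach of g10's `phatPart_of_descent22`. -/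

/-- `V(3;1⁷) = 98` and `V(3;2,1⁶) = −33`, in the `bSym` names (the values `SymRay.values_one`, `SymRay.values_one'`). -/
theorem coeffV_bSym : coeffV bSym = 98 ∧ coeffV bSym1 = -33 := by
  refine ⟨?_, ?_⟩
  · rw [← SymRay.bRay_one_eq]; exact SymRay.values_one.2.2
  · rw [← SymRay.bRay'_one_eq]; exact SymRay.values_one'.2.2

/-- **`Q₁ = 21`, `P̂₁ = 101/4` recovered** (Brown–Zudilin Sect. 2, (5) at `n = 1`), from the node:
`∃ P ∈ ℚ, I(1,…,1) = 21·(2ζ(5)+4ζ(3)ζ(2)) − 4·(101/4)·ζ(2) − 2P`. -/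
theorem phatOne_of_LD (h : phatPartResidueLD) :
    ∃ P : ℚ, cellularIntegral ![1, 1, 1, 1, 1, 1, 1, 1] =
      (21 : ℝ) * (2 * zetaValue 5 + 4 * zetaValue 3 * zetaValue 2) - 4 * ((101 / 4 : ℚ) : ℝ) * zetaValue 2 - 2 * (P : ℝ) := by
  obtain ⟨P, hP⟩ := h ![1, 1, 1, 1, 1, 1, 1, 1] 1 (by decide) (by decide) (by decide) (by decide) (by decide) (by decide)
    (by decide) (by decide) (by decide) (by decide)
  refine ⟨P, ?_⟩
  rw [hP, QOf_ones, rhoOf_ones, bOfA_ones, update_bSym, coeff_bSym.1, coeff_bSym1.1, coeffV_bSym.1, coeffV_bSym.2]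
  push_cast
  ring

/-- **END-TO-END INSTANCE, `n = 1`.** The same from the three cited facts (Brown–Zudilin (22), Zudilin 2002 `J₃ = λ·F̃₅`, Zudilin 2004
on the closed cone): `∃ P ∈ ℚ, I(1,…,1) = 21·(2ζ(5)+4ζ(3)ζ(2)) − 4·(101/4)·ζ(2) − 2P`. -/
theorem phatOne_of_descent22 (h22 : descent22) (hZ : vwp_eq_integral_of_pos) (hBc : baileyTransformClosed) :
    ∃ P : ℚ, cellularIntegral ![1, 1, 1, 1, 1, 1, 1, 1] =
      (21 : ℝ) * (2 * zetaValue 5 + 4 * zetaValue 3 * zetaValue 2) - 4 * ((101 / 4 : ℚ) : ℝ) * zetaValue 2 - 2 * (P : ℝ) :=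
  phatOne_of_LD (phatPartLD_of_descent22 h22 hZ hBc)

/-! The second printed case, `a = (2,…,2)`: `b = (6;2⁷)`, `b′ = (6;3,2⁶)`, `U = 469/8`, `V = 74463/256`, `U′ = −69`, `V′ = −43085/128`
(`WedgeDictionaryInstanceTwos`, `SymRayInitialValues`), `ρ(2⁸) = 32/3`, `Q(2⁸) = 2989`; hence
`P̂₂ = (32/3)·((469/8)(−43085/128) − (−69)(74463/256)) = (32/3)·(344923/1024) = 344923/96` — printed: `Q₂ = 2989`, `P̂₂ = 344923/96`
(arXiv:2210.03391 Sect. 2, (5); `P₂ = 1190161/384` not addressed).  Three support terms `k = 2, 3, 4` of (22), `B(4) = (6;2,0,2,2,2)` on a face. -/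

/-- `SymRay.bRay 2 = bSym2 = (6;2⁷)` and `SymRay.bRay' 2 = bSym2p = (6;3,2⁶)` (the names of `WedgeDictionaryInstanceTwos`). -/
theorem bRay_two_eq : SymRay.bRay 2 = bSym2 ∧ SymRay.bRay' 2 = bSym2p := by
  have h : SymRay.bRay 2 = bSym2 := by
    funext j; simp [SymRay.bRay, bSym2]
  exact ⟨h, by rw [SymRay.bRay', h]; exact update_bSym2⟩

/-- `V(6;2⁷) = 74463/256` and `V(6;3,2⁶) = −43085/128` (the values `SymRay.values_two`, `SymRay.values_two'`). -/
theorem coeffV_bSym2 : coeffV bSym2 = 74463 / 256 ∧ coeffV bSym2p = -43085 / 128 := by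
  refine ⟨?_, ?_⟩
  · rw [← bRay_two_eq.1]; exact SymRay.values_two.2.2
  · rw [← bRay_two_eq.2]; exact SymRay.values_two'.2.2

/-- **`Q₂ = 2989`, `P̂₂ = 344923/96` recovered** (Brown–Zudilin Sect. 2, (5) at `n = 2`), from the node:
`∃ P ∈ ℚ, I(2,…,2) = 2989·(2ζ(5)+4ζ(3)ζ(2)) − 4·(344923/96)·ζ(2) − 2P`. -/
theorem phatTwo_of_LD (h : phatPartResidueLD) :
    ∃ P : ℚ, cellularIntegral ![2, 2, 2, 2, 2, 2, 2, 2] =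
      (2989 : ℝ) * (2 * zetaValue 5 + 4 * zetaValue 3 * zetaValue 2) - 4 * ((344923 / 96 : ℚ) : ℝ) * zetaValue 2 - 2 * (P : ℝ) := by
  obtain ⟨P, hP⟩ := h ![2, 2, 2, 2, 2, 2, 2, 2] 1 (by decide) (by decide) (by decide) (by decide) (by decide) (by decide)
    (by decide) (by decide) (by decide) (by decide)
  refine ⟨P, ?_⟩
  rw [hP, QOf_twos, rhoOf_twos, bOfA_twos, update_bSym2, coeff_bSym2.1, coeff_bSym2p.1, coeffV_bSym2.1, coeffV_bSym2.2]
  push_cast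
  ring

/-- **END-TO-END INSTANCE, `n = 2`**, from the three cited facts. -/
theorem phatTwo_of_descent22 (h22 : descent22) (hZ : vwp_eq_integral_of_pos) (hBc : baileyTransformClosed) :
    ∃ P : ℚ, cellularIntegral ![2, 2, 2, 2, 2, 2, 2, 2] =
      (2989 : ℝ) * (2 * zetaValue 5 + 4 * zetaValue 3 * zetaValue 2) - 4 * ((344923 / 96 : ℚ) : ℝ) * zetaValue 2 - 2 * (P : ℝ) :=
  phatTwo_of_LD (phatPartLD_of_descent22 h22 hZ hBc)

end Summit.KontsevichZagierPeriods.Zeta5Search.WedgeDictionary
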